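import Summits.QuantumFields.YangMills.Theorems.AlphaInputsT3ACData
import HarnessLib

/-!
# `AlphaInputsT3AC` — THE BRIDGE, PART 3: the assembled datum's HISTORY FUNCTIONAL OPENED as the interface's `LFData` (`lfDataT3`) with
# `LFSum` PROVED, the characteristic function `χ_j` identified with the route's window `θBal(K − j)` (`NoTrivOnLarge` clause 1 PROVED with
# `Cχ = 1`), and the trivial history's weight exposed (`≥ 1` at every datum — the located obstruction to `NoTrivOnLarge` clause 2 / `TrivTerm`)

Lane `pub-balaban3d`, seat alpha-1 (LINE 2 of `defn-AlphaInputsT3AC`, route `UnitScaleTilt`); consumer: crux 18916 `HistoryTail` S5 (★ym-ust-18916-p1: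
«`LFData` CONCRETE … or the stubs stated for alpha-1's concrete `D_of`», bus 2026-08-26T19:18:50Z), whose common hypothesis is
`T3AlphaInputsACSchemas.AlphaInputsT3ACFull D W … = package ∧ LFSum D W ∧ LargePSpec ∧ NoTrivOnLarge ∧ SmallFactor71`.

* §1 `T3Scales_pow_mul_eps`, `T3Scales_gk_eq`, `eps1_inputOfAC_T3_eq` — at the T³ scales the lane's running coupling IS the route's:
  `g_j = √(γ·L^{−(K−j)})` and the small-field threshold `ε₁(j) = g_j p(g_j)` IS `θBal F.L γ b₀ p₀ (K − j)` (`j ≤ K`; `b₀, p₀` the record's);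
  hence `dataT3_chi_eq` (`χ^{(K)}_j = chiSmall univ (θBal (K − j))`), `dataT3_chi_eq_zero_of_le` (= `NoTrivOnLarge` clause 1, `Cχ = 1`) and
  `dataT3_chi_eq_one_of_plaqSmall` (the window is charged).
* §2 `AlphaInputsT3AC.Of.lfDataT3` — the interface's `LFData` for `dataT3`: region histories `Reg := Carriers.Hist` (the lane's histories ARE
  region histories: the large-field plaquette sets per passage, finitely many), `assemble r v := r` (the lane's masses have the large-field
  FIELDS already integrated out — reading D-41 of the lane — so the fibre variable `v` is dummy), `wt r v W := m_j(r, W)` (the uncapped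
  Radon–Nikodym mass), `LargeP r i := P_i(r)` for admissible `r` and `i < j` (else `∅`).  `dataT3_lfSum : LFSum D W` PROVED (fibre integral of a
  constant over a probability measure).  `lfDataT3_one_le_wt_trivReg`: the trivial region history's weight is `≥ 1` at EVERY datum (the lane's
  floor `MassesAC.one_le_massRecAC_triv`) — so `NoTrivOnLarge` clause 2 («a `2L²B₃θ`-large plaquette kills the trivial weight») and 18916's
  proposed `TrivTerm` («`wt triv = χ`») are FALSE for `lfDataT3` whenever such a datum exists: finding F-α1-3 of the seat (repair = un-floor
  the trivial mass to print's characteristic function in `MassesAC`, or condition those clauses on the datum window).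
NOT here: `LargePSpec` (geometric half provable from `Carriers.plaqCover_subset_Lam`; its datum-largeness half is the lane's row `hLF67` on
LIFTED minimisers — a lift↔torus bridge is needed), `SmallFactor71` ((70)–(71): an (α) row about the composite minimiser, not in `RunAlphaAC`).
CONDITIONAL on the package; nothing of [Balaban1985UV3] is asserted.

References: T. Bałaban, Commun. Math. Phys. 102 (1985) 255–275 [Balaban1985UV3], (3) p.256, (7) p.257, (38)–(41) p.266, (47) p.267.
-/

set_option autoImplicit false

noncomputable section

namespace Summit.QuantumFields.YangMills.Theorems

open MeasureTheory
open Literature.MathematicalPhysics.QuantumFieldTheory.Balaban1983to89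
open Literature.MathematicalPhysics.QuantumFieldTheory.Balaban1983to89.T3ContinuumYM3Torus
open Literature.MathematicalPhysics.QuantumFieldTheory.Balaban1983to89.T3UnitLawDensityEML (ℰp)
open Literature.MathematicalPhysics.QuantumFieldTheory.Balaban1983to89.T3UnitScaleTilt (θBal)
open Literature.MathematicalPhysics.QuantumFieldTheory.Balaban1983to89.T3AlphaInputsAC
open Literature.MathematicalPhysics.QuantumFieldTheory.Balaban1983to89.T3AlphaInputsACSchemas
open Literature.MathematicalPhysics.QuantumFieldTheory.Balaban1985CMP102
open Literature.MathematicalPhysics.QuantumFieldTheory.Balaban1985CMP102.Setting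
open Summit.QuantumFields.Balaban3D.Carriers
open Summit.QuantumFields.Balaban3D.Proofs.Primitives
open Summit.QuantumFields.Balaban3D.Proofs.ScalesArithmetic (gk_def)
open Summit.QuantumFields.Balaban3D.Proofs.TowerAC
open Summit.QuantumFields.Balaban3D.Proofs.StandardAC
open Summit.QuantumFields.Balaban3D.Proofs.InputsAC

/-! ## §1 The running coupling and the small-field threshold at the T³ scales -/

section Thresholds

variable (F : T3Family) (γ : ℝ) (hγ : 0 < γ) (hγ1 : γ ≤ 1) (K : ℕ)

/-- `Lʲε_K = L^{−(K−j)}` for `j ≤ K` at the T³ scales (`ε_K = L^{−K}`). [cite: Balaban1985UV3, (3) p.256] -/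
theorem T3Scales_pow_mul_eps (j : ℕ) (hj : j ≤ K) :
    (F.L : ℝ) ^ j * (T3Scales F γ hγ hγ1 K).ε = ((F.L : ℝ)⁻¹) ^ (K - j) := by
  have hL : (0 : ℝ) < F.L := by exact_mod_cast (zero_lt_one.trans F.hL.2)
  show (F.L : ℝ) ^ j * ((F.L : ℝ)⁻¹) ^ K = ((F.L : ℝ)⁻¹) ^ (K - j)
  rw [inv_pow, inv_pow, show (F.L : ℝ) ^ K = (F.L : ℝ) ^ j * (F.L : ℝ) ^ (K - j) by
    rw [← pow_add, Nat.add_sub_cancel' hj], mul_inv, ← mul_assoc, mul_inv_cancel₀ (pow_ne_zero _ hL.ne'), one_mul]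

/-- **THE LANE'S RUNNING COUPLING AT THE T³ SCALES IS THE ROUTE'S**: `g_j = g(Lʲε)^{1/2} = √(γ·L^{−(K−j)})` for `j ≤ K` (`g = √γ`,
`ε = L^{−K}`) — the `g_i` inside `T3UnitScaleTilt.θBal` at distance `i = K − j` from the unit scale. [cite: Balaban1985UV3, (3) p.256] -/
theorem T3Scales_gk_eq (j : ℕ) (hj : j ≤ K) :
    (T3Scales F γ hγ hγ1 K).gk j = Real.sqrt (γ * ((F.L : ℝ)⁻¹) ^ (K - j)) := by
  rw [gk_def, T3Scales_pow_mul_eps F γ hγ hγ1 K j hj, Real.sqrt_mul hγ.le]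
  rfl

variable {F γ hγ K} {𝔠 : AlphaConsts F.L (suGroupModel 2).N} {hγ1' : γ ≤ (min 𝔠.gamma0 1) ^ 2}

/-- **THE LANE'S SMALL-FIELD THRESHOLD IS THE ROUTE'S WINDOW**: `ε₁(j) = g_j p(g_j) = θBal F.L γ b₀ p₀ (K − j)` for `j ≤ K`, with the record's
`b₀, p₀` ((7) p.257 «ε₁ = g₀p(g₀)»). [cite: Balaban1985UV3, (7) p.257] -/
theorem AlphaInputsT3AC.PkgAt.eps1_eq (p : AlphaInputsT3AC.PkgAt F 𝔠 γ hγ hγ1' K) (j : ℕ) (hj : j ≤ K) :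
    (inputOfAC 𝔠.lane p.X p.𝔖).ε₁ j = θBal F.L γ 𝔠.b₀ 𝔠.p₀ (K - j) := by
  show (T3Scales F γ hγ (hγ1'.trans (sq_min_one_le _ 𝔠.gamma0_pos)) K).gk j *
      B10.pFun 𝔠.b₀ 𝔠.p₀ ((T3Scales F γ hγ (hγ1'.trans (sq_min_one_le _ 𝔠.gamma0_pos)) K).gk j) = _
  rw [T3Scales_gk_eq F γ hγ _ K j hj]
  rfl

end Thresholds

section Chi

variable {F : T3Family} {𝔠 : AlphaConsts F.L (suGroupModel 2).N}
  (h : AlphaInputsT3AC.Of F 𝔠) (γ : ℝ) (hγ : 0 < γ) (hγ1 : γ ≤ (min 𝔠.gamma0 1) ^ 2) (π : AlphaInputsT3AC.PolymerT3 F)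

/-- **THE ASSEMBLED DATUM'S `χ_j` IS THE INDICATOR OF THE ROUTE'S WINDOW**: for `j ≤ K`, `χ^{(K)}_j(W) = chiSmall univ (θBal(K − j)) W` —
(47) p.267 «the characteristic function χ_k corresponds to the restrictions on V given by the conditions |U_k(∂p) − 1| < g_k p(g_k)η²», read on
the level-`j` datum (the lane's `Setup.chiSmall` at `ε₁(j) = g_j p(g_j)`). [cite: Balaban1985UV3, (47) p.267] -/
theorem AlphaInputsT3AC.Of.dataT3_chi_eq (K j : ℕ) (hj : j ≤ K) (W : GaugeField (F.P K) j (Matrix.specialUnitaryGroup (Fin 2) ℂ)) :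
    (h.dataT3 γ hγ hγ1 π).χ K j W = chiSmall Set.univ (θBal F.L γ 𝔠.b₀ 𝔠.p₀ (K - j)) W := by
  rw [← (h.pkgAt γ hγ hγ1 K).eps1_eq j hj]
  rfl

/-- **`NoTrivOnLarge` CLAUSE 1 FOR THE ASSEMBLED DATUM, `Cχ = 1`**: a level-`j` datum with ONE plaquette at distance `≥ θBal(K − j)` from `1`
has `χ_j = 0`. [cite: Balaban1985UV3, (47) p.267] -/
theorem AlphaInputsT3AC.Of.dataT3_chi_eq_zero_of_le (K j : ℕ) (hj : j ≤ K)
    (W : GaugeField (F.P K) j (Matrix.specialUnitaryGroup (Fin 2) ℂ)) (q : Plaq (F.P K) j)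
    (hq : 1 * θBal F.L γ 𝔠.b₀ 𝔠.p₀ (K - j) ≤ GaugeGroup.dist1 (GaugeField.plaqHol W q)) :
    (h.dataT3 γ hγ hγ1 π).χ K j W = 0 := by
  rw [h.dataT3_chi_eq γ hγ hγ1 π K j hj W]
  unfold chiSmall
  rw [if_neg]
  intro hsmall
  have hlt := hsmall q (Set.mem_univ q)
  linarith

/-- Conversely the window is charged: a `θBal(K − j)`-small datum has `χ_j = 1`. [cite: Balaban1985UV3, (47) p.267] -/
theorem AlphaInputsT3AC.Of.dataT3_chi_eq_one_of_plaqSmall (K j : ℕ) (hj : j ≤ K)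
    (W : GaugeField (F.P K) j (Matrix.specialUnitaryGroup (Fin 2) ℂ)) (hW : PlaqSmall (θBal F.L γ 𝔠.b₀ 𝔠.p₀ (K - j)) W) :
    (h.dataT3 γ hγ hγ1 π).χ K j W = 1 := by
  rw [h.dataT3_chi_eq γ hγ hγ1 π K j hj W]
  unfold chiSmall
  rw [if_pos]
  exact fun q _ => hW q

/-- Hence on the window the minorant `low_j` is the bare exponential `exp(−mainT_j(triv, W) + Pint_j(triv, W)) > 0`. [cite: Balaban1985UV3, (47) p.267] -/
theorem AlphaInputsT3AC.Of.dataT3_low_pos_of_plaqSmall (K j : ℕ) (hj : j ≤ K)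
    (W : GaugeField (F.P K) j (Matrix.specialUnitaryGroup (Fin 2) ℂ)) (hW : PlaqSmall (θBal F.L γ 𝔠.b₀ 𝔠.p₀ (K - j)) W) :
    0 < (h.dataT3 γ hγ hγ1 π).low K j W := by
  unfold AlphaDataT3.low
  rw [h.dataT3_chi_eq_one_of_plaqSmall γ hγ hγ1 π K j hj W hW, one_mul]
  exact Real.exp_pos _

end Chi

/-! ## §2 The history functional opened: `lfDataT3`, `LFSum`, and the trivial weight -/

section Histories

variable {F : T3Family} {𝔠 : AlphaConsts F.L (suGroupModel 2).N}

open Classical in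
/-- **THE INTERFACE'S `LFData` FOR THE ASSEMBLED DATUM**: region histories := the lane's discrete histories `Carriers.Hist (F.P K) j` (the
large-field plaquette sets `(P_i)_{i<j}`, finitely many on the finite torus); `trivReg := Hist.triv`; `assemble r v := r` — the lane's masses
have the large-field fields `(V_i)_{i<j}` of (41) already integrated out (the exact Radon–Nikodym transports of `MassesAC`), so the fibre
variable is dummy; `wt r v W := m_j(r, W) ≥ 0`; `LargeP r i := P_i(r)` for admissible `r` (`Carriers.Hist.Admissible` at the input's `M₁`, `Rcol`)
and `i < j`, else `∅`. [cite: Balaban1985UV3, (38)-(41) p.266] -/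
def AlphaInputsT3AC.Of.lfDataT3 (h : AlphaInputsT3AC.Of F 𝔠) (γ : ℝ) (hγ : 0 < γ) (hγ1 : γ ≤ (min 𝔠.gamma0 1) ^ 2)
    (π : AlphaInputsT3AC.PolymerT3 F) : LFData (h.dataT3 γ hγ hγ1 π) where
  Reg := fun K j => Hist (F.P K) j
  regFintype := fun _ _ => inferInstance
  trivReg := fun K j => Hist.triv (F.P K) j
  assemble := fun _ _ r _ => r
  wt := fun K j r _ W => (inputOfAC 𝔠.lane (h.pkgAt γ hγ hγ1 K).X (h.pkgAt γ hγ hγ1 K).𝔖).W.mass j r W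
  LargeP := fun K j r i =>
    if hij : i < j ∧ Hist.Admissible (inputOfAC 𝔠.lane (h.pkgAt γ hγ hγ1 K).X (h.pkgAt γ hγ hγ1 K).𝔖).M₁
        (inputOfAC 𝔠.lane (h.pkgAt γ hγ hγ1 K).X (h.pkgAt γ hγ hγ1 K).𝔖).Rcol j r
    then r ⟨i, hij.1⟩ else ∅

variable (h : AlphaInputsT3AC.Of F 𝔠) (γ : ℝ) (hγ : 0 < γ) (hγ1 : γ ≤ (min 𝔠.gamma0 1) ^ 2) (π : AlphaInputsT3AC.PolymerT3 F)

/-- The weight of `lfDataT3` is the mass (definitional; the fibre variable is dummy). [cite: Balaban1985UV3, (41) p.266] -/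
theorem AlphaInputsT3AC.Of.lfDataT3_wt_eq (K j : ℕ) (r : Hist (F.P K) j)
    (v : (i : Fin j) → GaugeField (F.P K) i (Matrix.specialUnitaryGroup (Fin 2) ℂ))
    (W : GaugeField (F.P K) j (Matrix.specialUnitaryGroup (Fin 2) ℂ)) :
    (h.lfDataT3 γ hγ hγ1 π).wt K j r v W = (inputOfAC 𝔠.lane (h.pkgAt γ hγ hγ1 K).X (h.pkgAt γ hγ hγ1 K).𝔖).W.mass j r W := rfl

/-- The assembled history is the region history itself (definitional). [cite: Balaban1985UV3, (38) p.266] -/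
theorem AlphaInputsT3AC.Of.lfDataT3_assemble_eq (K j : ℕ) (r : Hist (F.P K) j)
    (v : (i : Fin j) → GaugeField (F.P K) i (Matrix.specialUnitaryGroup (Fin 2) ℂ)) :
    (h.lfDataT3 γ hγ hγ1 π).assemble K j r v = r := rfl

/-- **`LFSum` FOR THE ASSEMBLED DATUM — PROVED**: the weight is non-negative, the trivial region history assembles to the trivial history, and
`LF_j(W)[Φ] = Σ_r ∫ wt(r, v, W)·e^{Φ(assemble r v)} dv` — here `Σ_h m_j(h, W)·e^{Φ(h)}` with the integrand constant in the dummy fibre variable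
and `dv` a probability measure (product of normalised Haar measures). [cite: Balaban1985UV3, (41) p.266] -/
theorem AlphaInputsT3AC.Of.dataT3_lfSum : LFSum (h.dataT3 γ hγ hγ1 π) (h.lfDataT3 γ hγ hγ1 π) := by
  refine ⟨fun K j r v W => ?_, fun K j v => rfl, fun K j W Φ => ?_⟩
  · exact (inputOfAC 𝔠.lane (h.pkgAt γ hγ hγ1 K).X (h.pkgAt γ hγ hγ1 K).𝔖).W.mass_nonneg j r W
  · show ∑ r : Hist (F.P K) j, (inputOfAC 𝔠.lane (h.pkgAt γ hγ hγ1 K).X (h.pkgAt γ hγ hγ1 K).𝔖).W.mass j r W * Real.exp (Φ r) =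
      ∑ r : Hist (F.P K) j, ∫ _v, (inputOfAC 𝔠.lane (h.pkgAt γ hγ hγ1 K).X (h.pkgAt γ hγ hγ1 K).𝔖).W.mass j r W * Real.exp (Φ r)
        ∂Measure.pi fun i : Fin j => fieldMeasure (F.P K) (i : ℕ) (Matrix.specialUnitaryGroup (Fin 2) ℂ)
    refine Finset.sum_congr rfl fun r _ => ?_
    rw [integral_const, smul_eq_mul]
    simp

/-- **THE TRIVIAL REGION HISTORY'S WEIGHT IS `≥ 1` AT EVERY DATUM** (the lane's floor `MassesAC.one_le_massRecAC_triv`): in particular it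
NEVER vanishes — so the interface's `NoTrivOnLarge` clause 2 and the 18916 readiness clause `TrivTerm` («`wt triv = χ`») fail for `lfDataT3` at
any datum with a large plaquette (seat finding F-α1-3; print's trivial weight is the characteristic function «χ_k», (40)–(41) p.266, (47)
p.267). [cite: Balaban1985UV3, (40)-(41) p.266] -/
theorem AlphaInputsT3AC.Of.lfDataT3_one_le_wt_trivReg (K j : ℕ)
    (v : (i : Fin j) → GaugeField (F.P K) i (Matrix.specialUnitaryGroup (Fin 2) ℂ))
    (W : GaugeField (F.P K) j (Matrix.specialUnitaryGroup (Fin 2) ℂ)) :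
    1 ≤ (h.lfDataT3 γ hγ hγ1 π).wt K j ((h.lfDataT3 γ hγ hγ1 π).trivReg K j) v W :=
  one_le_stdTowerInputAC_mass_triv (h.pkgAt γ hγ hγ1 K).X 𝔠.lane.carrier (h.pkgAt γ hγ hγ1 K).𝔖 j W

/-- Hence the trivial weight never vanishes. [cite: Balaban1985UV3, (41) p.266] -/
theorem AlphaInputsT3AC.Of.lfDataT3_wt_trivReg_ne_zero (K j : ℕ)
    (v : (i : Fin j) → GaugeField (F.P K) i (Matrix.specialUnitaryGroup (Fin 2) ℂ))
    (W : GaugeField (F.P K) j (Matrix.specialUnitaryGroup (Fin 2) ℂ)) :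
    (h.lfDataT3 γ hγ hγ1 π).wt K j ((h.lfDataT3 γ hγ hγ1 π).trivReg K j) v W ≠ 0 :=
  ne_of_gt (lt_of_lt_of_le one_pos (h.lfDataT3_one_le_wt_trivReg γ hγ hγ1 π K j v W))

/-- The weight vanishes, pointwise, on inadmissible region histories (`StandardAC.stdTowerInputAC_mass_eq_zero_of_not_admissible`).
[cite: Balaban1985UV3, pp.267-268] -/
theorem AlphaInputsT3AC.Of.lfDataT3_wt_eq_zero_of_not_admissible (K j : ℕ) (r : Hist (F.P K) j)
    (hr : ¬ Hist.Admissible (inputOfAC 𝔠.lane (h.pkgAt γ hγ hγ1 K).X (h.pkgAt γ hγ hγ1 K).𝔖).M₁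
      (inputOfAC 𝔠.lane (h.pkgAt γ hγ hγ1 K).X (h.pkgAt γ hγ hγ1 K).𝔖).Rcol j r)
    (v : (i : Fin j) → GaugeField (F.P K) i (Matrix.specialUnitaryGroup (Fin 2) ℂ))
    (W : GaugeField (F.P K) j (Matrix.specialUnitaryGroup (Fin 2) ℂ)) :
    (h.lfDataT3 γ hγ hγ1 π).wt K j r v W = 0 :=
  stdTowerInputAC_mass_eq_zero_of_not_admissible (h.pkgAt γ hγ hγ1 K).X 𝔠.lane.carrier (h.pkgAt γ hγ hγ1 K).𝔖 j r W hr

/-- `LargeP` lists large-field plaquettes only below the history's level: `LargeP K j r i = ∅` for `j ≤ i`. [cite: Balaban1985UV3, (38) p.266] -/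
theorem AlphaInputsT3AC.Of.lfDataT3_largeP_of_le (K j : ℕ) (r : Hist (F.P K) j) (i : ℕ) (hi : j ≤ i) :
    (h.lfDataT3 γ hγ hγ1 π).LargeP K j r i = ∅ := by
  dsimp only [AlphaInputsT3AC.Of.lfDataT3]
  rw [dif_neg]
  exact fun hij => absurd hij.1 (not_lt.mpr hi)

/-- … and nothing for inadmissible region histories. [cite: Balaban1985UV3, pp.267-268] -/
theorem AlphaInputsT3AC.Of.lfDataT3_largeP_of_not_admissible (K j : ℕ) (r : Hist (F.P K) j)
    (hr : ¬ Hist.Admissible (inputOfAC 𝔠.lane (h.pkgAt γ hγ hγ1 K).X (h.pkgAt γ hγ hγ1 K).𝔖).M₁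
      (inputOfAC 𝔠.lane (h.pkgAt γ hγ hγ1 K).X (h.pkgAt γ hγ hγ1 K).𝔖).Rcol j r) (i : ℕ) :
    (h.lfDataT3 γ hγ hγ1 π).LargeP K j r i = ∅ := by
  dsimp only [AlphaInputsT3AC.Of.lfDataT3]
  rw [dif_neg]
  exact fun hij => hr hij.2

/-- For an admissible region history and `i < j`, `LargeP K j r i` IS its recorded level-`i` large-field set `P_i(r)`. [cite: Balaban1985UV3, (38) p.266] -/
theorem AlphaInputsT3AC.Of.lfDataT3_largeP_of_admissible (K j : ℕ) (r : Hist (F.P K) j)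
    (hr : Hist.Admissible (inputOfAC 𝔠.lane (h.pkgAt γ hγ hγ1 K).X (h.pkgAt γ hγ hγ1 K).𝔖).M₁
      (inputOfAC 𝔠.lane (h.pkgAt γ hγ hγ1 K).X (h.pkgAt γ hγ hγ1 K).𝔖).Rcol j r) (i : ℕ) (hi : i < j) :
    (h.lfDataT3 γ hγ hγ1 π).LargeP K j r i = r ⟨i, hi⟩ := by
  dsimp only [AlphaInputsT3AC.Of.lfDataT3]
  rw [dif_pos ⟨hi, hr⟩]

end Histories

/-! ## §3 (appended) The geometric half of `LargePSpec` for `lfDataT3`: a listed large-field plaquette of level `i` lies below the history's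
level (`i < j`) and has its corners in `Λ_i` of the assembled history -/

section LargePGeom

open Literature.MathematicalPhysics.QuantumFieldTheory.Balaban1983to89.B10Eq38TorusDomains (toFine cornerSet plaqsIn mem_plaqsIn_iff)
open Literature.MathematicalPhysics.QuantumFieldTheory.Balaban1983to89.B10Eq42TorusConstraint (lam42 lam42_of_lt)

variable {P : Params}

/-- The lane's `coarsen j` (iterated `blockOf`) inverts the interface's `toFine j` (iterated `emb`) in the standing range. [folklore] -/
theorem coarsen_toFine : ∀ (j : ℕ), j ≤ P.m + P.K → ∀ y : Site P j, coarsen j (toFine j y) = y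
  | 0, _, _ => rfl
  | j + 1, hj, y => by
    show blockOf (coarsen j (toFine j (emb y))) = y
    rw [coarsen_toFine j (by omega) (emb y), Site.blockOf_emb hj]

/-- The interface's corner set of a plaquette (four fine representatives) lies in the lane's `plaqCover` (all fine sites of the four corner
blocks). [cite: Balaban1985UV3, (8) p.258 and (69) p.273] -/
theorem cornerSet_subset_plaqCover {j : ℕ} (hj : j ≤ P.m + P.K) (p : Plaq P j) : cornerSet j p ⊆ plaqCover p := by
  intro x hx
  simp only [cornerSet, Set.mem_insert_iff, Set.mem_singleton_iff] at hx
  show coarsen j x = p.src ∨ coarsen j x = p.src.shift p.μ ∨ coarsen j x = p.src.shift p.ν ∨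
    coarsen j x = (p.src.shift p.μ).shift p.ν
  rcases hx with hx | hx | hx | hx <;> rw [hx, coarsen_toFine j hj]
  · exact Or.inl rfl
  · exact Or.inr (Or.inl rfl)
  · exact Or.inr (Or.inr (Or.inl rfl))
  · exact Or.inr (Or.inr (Or.inr rfl))

variable (M₁ : ℕ) (Rcol : ℕ → ℕ)

/-- **EVERY RECORDED LARGE-FIELD PLAQUETTE OF AN ADMISSIBLE HISTORY COVERS ONLY `Λ_i`** (all passages, not just the last: `Carriers.plaqCover_subset_Lam`
descended along `Hist.proj` with `Lam_succ_of_lt`). [cite: Balaban1985UV3, p.273 L14] -/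
theorem plaqCover_subset_Lam_of_admissible :
    ∀ (k : ℕ) (r : Hist P k), Hist.Admissible M₁ Rcol k r → ∀ (i : ℕ) (hi : i < k), ∀ p ∈ r ⟨i, hi⟩,
      plaqCover p ⊆ Lam M₁ Rcol r i
  | 0, _, _, _, hi, _, _ => absurd hi (Nat.not_lt_zero _)
  | k + 1, r, hr, i, hi, p, hp => by
    by_cases hik : i < k
    · rw [Lam_succ_of_lt M₁ Rcol r (by omega : i + 1 ≤ k)]
      exact plaqCover_subset_Lam_of_admissible k r.proj hr.proj i hik p hp
    · have hik' : i = k := by omega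
      subst hik'
      exact plaqCover_subset_Lam M₁ Rcol hr hp

variable {F : T3Family} {𝔠 : AlphaConsts F.L (suGroupModel 2).N}
  (h : AlphaInputsT3AC.Of F 𝔠) (γ : ℝ) (hγ : 0 < γ) (hγ1 : γ ≤ (min 𝔠.gamma0 1) ^ 2) (π : AlphaInputsT3AC.PolymerT3 F)

/-- Below the top index the assembled datum's `Λ_i(h)` IS the lane's `Carriers.Lam` (definitional up to `lam42_of_lt`). [cite: Balaban1985UV3, (40)-(42) p.266] -/
theorem AlphaInputsT3AC.Of.dataT3_Λ_eq_Lam (K j : ℕ) (r : Hist (F.P K) j) (i : ℕ) (hi : i < j) :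
    (h.dataT3 γ hγ hγ1 π).Λ K j r i =
      Lam (inputOfAC 𝔠.lane (h.pkgAt γ hγ hγ1 K).X (h.pkgAt γ hγ hγ1 K).𝔖).M₁
        (inputOfAC 𝔠.lane (h.pkgAt γ hγ hγ1 K).X (h.pkgAt γ hγ hγ1 K).𝔖).Rcol r i := by
  show lam42 _ j i = _
  rw [lam42_of_lt hi]
  rfl

/-- **`LargePSpec`, GEOMETRIC HALF, FOR `lfDataT3` — PROVED**: if `p′ ∈ LargeP K j r i` (so `r` is admissible, `i < j`, `p′ ∈ P_i(r)`) and
`j ≤ K`, then `i < j` and `p′ ∈ plaqsIn i (Λ_i(assemble r v))` — its four corners lie in `Λ_i = Ω_i ∖ Ω_{i+1}` of the history ((67) p.273 «a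
plaquette p′ ⊂ Λ_j»).  The remaining conjunct of `LargePSpec` (the `i`-fold `blockAvg ℰp` average of the composite minimiser is `θBal(K−i)`-LARGE
at `p′`) is the lane's (α) row `hLF67`, stated there on LIFTED minimisers — not derived here. [cite: Balaban1985UV3, (67) p.273] -/
theorem AlphaInputsT3AC.Of.lfDataT3_largeP_geom (K j : ℕ) (hj : j ≤ K) (r : Hist (F.P K) j)
    (v : (i : Fin j) → GaugeField (F.P K) i (Matrix.specialUnitaryGroup (Fin 2) ℂ)) (i : ℕ) (p' : Plaq (F.P K) i)
    (hp : p' ∈ (h.lfDataT3 γ hγ hγ1 π).LargeP K j r i) :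
    i < j ∧ p' ∈ plaqsIn i ((h.dataT3 γ hγ hγ1 π).Λ K j ((h.lfDataT3 γ hγ hγ1 π).assemble K j r v) i) := by
  by_cases hij : i < j ∧ Hist.Admissible (inputOfAC 𝔠.lane (h.pkgAt γ hγ hγ1 K).X (h.pkgAt γ hγ hγ1 K).𝔖).M₁
      (inputOfAC 𝔠.lane (h.pkgAt γ hγ hγ1 K).X (h.pkgAt γ hγ hγ1 K).𝔖).Rcol j r
  · rw [h.lfDataT3_largeP_of_admissible γ hγ hγ1 π K j r hij.2 i hij.1] at hp
    refine ⟨hij.1, ?_⟩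
    rw [h.lfDataT3_assemble_eq γ hγ hγ1 π, h.dataT3_Λ_eq_Lam γ hγ hγ1 π K j r i hij.1, mem_plaqsIn_iff]
    have hiK : i ≤ (F.P K).m + (F.P K).K := by
      show i ≤ F.m + K
      omega
    exact (cornerSet_subset_plaqCover hiK p').trans
      (plaqCover_subset_Lam_of_admissible _ _ j r hij.2 i hij.1 p' hp)
  · exfalso
    have h0 : (h.lfDataT3 γ hγ hγ1 π).LargeP K j r i = ∅ := by
      dsimp only [AlphaInputsT3AC.Of.lfDataT3]
      rw [dif_neg hij]
    rw [h0] at hp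
    simp at hp

end LargePGeom

end Summit.QuantumFields.YangMills.Theorems

end
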